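import Literature.Probability.RandomPlanarGeometry.SAWTriangularHalfSpaceRatioLimit
import Literature.Probability.RandomPlanarGeometry.SAWTriangularHalfSpaceInsertion
import Literature.Probability.RandomPlanarGeometry.SAWTriangularBridgeHalfSpaceConcat
import Literature.Probability.RandomPlanarGeometry.SAWRatioRateUpperCubeRoot
import Literature.Probability.RandomPlanarGeometry.SAWEndpointRateLowerInsertion
import Mathlib.Analysis.SpecialFunctions.Pow.Real
import HarnessLib

/-!
# Kesten's ratio rate for half-space walks of the triangular lattice: `|h_{N+1}(𝕋)/h_N(𝕋) − μ(𝕋)| ≤ K N^{-1/3}`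

Topic `Literature/Probability/RandomPlanarGeometry` (continues `SAWTriangularHalfSpaceRatioLimit.lean`: the ratio
limit `h_{N+1}(𝕋)/h_N(𝕋) → μ(𝕋)` and Kesten's inequality `kestenIneqTriHalfSpace`; `SAWTriangularHalfSpaceInsertion.lean`:
`h_n · b_M ≤ (n+1) · h_{n+M}` and `h_{n+M} ≤ h_n · c_M`; `SAWTriangularHammersleyWelsh.lean`/`SAWTriangularBridgeConstant.lean`:
`triHW`, `exp_neg_mul_pow_le_brickBridgeCount`; and the abstract `1/3`-rate lemmas `Zd.KestenRateUpper.upper_rate_cubeRoot_sub`,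
`Zd.KestenRateLower.lower_rate_cubeRoot_ins`).  Sibling, word for word, of `SAWTriangularRatioRate.lean` (the same
statement for all walks `c_N(𝕋)`), with `c` replaced by `h` in the ratio, `c_{m+M} ≤ c_m c_M` replaced by
`h_{m+M} ≤ h_m c_M`, and the bridge insertion into all walks replaced by the bridge insertion into half-space walks.

Source and printed status. Madras–Slade, *The Self-Avoiding Walk* (1993), §7.5 eq. (7.5.1) p. 255 prints Kesten's
`N^{-1/3}` rate for the two-step ratio of ALL walks on `ℤ^d` (no proof in the book); for half-space walks the one-step
LIMIT on `ℤ^d` is Lawler–Schramm–Werner 2004, Appendix A, (A.3) [cite: LawlerSchrammWerner2004SAW, Appendix A, (A.3)]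
(no rate; the tree has `K/log N`, `Zd.halfSpaceRatio_rate_log`); for `𝕋` neither limit nor rate is located in print.
This file proves, for every `N ≥ 1`,

  **`abs_brickHalfSpaceCount_ratio_sub_le_rpow : ∃ K, ∀ N ≥ 1, |h_{N+1}(𝕋)/h_N(𝕋) − μ(𝕋)| ≤ K · N^{−1/3}`.**

## Main statements (namespace `Literature.Probability.RandomPlanarGeometry.SAW`)

* `kestenIneqTriHalfSpace_all` — (7.3.3) for `h(𝕋)`, all `n ≥ 1`;
* `brickHalfSpaceCount_ratio_sub_le_rpow`, `le_brickHalfSpaceCount_ratio_sub_rpow` — the two sides;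
* **`abs_brickHalfSpaceCount_ratio_sub_le_rpow`**, `brickHalfSpaceCount_ratio_rate` (`∀ᶠ` form),
  `brickHalfSpaceCount_ratio_rate_eventually` (the lane's face `TriHalfSpaceRatioRate` verbatim).
-/

noncomputable section

open Filter Topology Finset

namespace Literature.Probability.RandomPlanarGeometry.SAW

/-! ### Two inputs in the shape the abstract lemmas consume -/

/-- `1 ≤ h_{N+1}(𝕋)/h_N(𝕋)`. [cite: MadrasSlade1993, Definition 3.1.2 and §1.2 eq. (1.2.15)] -/
theorem one_le_brickHalfSpaceCount_ratio (N : ℕ) :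
    (1 : ℝ) ≤ (brickHalfSpaceCount (N + 1) : ℝ) / brickHalfSpaceCount N := by
  have h0 : (0 : ℝ) < brickHalfSpaceCount N := by exact_mod_cast one_le_brickHalfSpaceCount N
  rw [le_div_iff₀ h0, one_mul]
  exact_mod_cast brickHalfSpaceCount_le_succ N

/-- `h_m(𝕋) · b_M(𝕋) ≤ (4m + 4M + 3)^6 · h_{m+M}(𝕋)` (the insertion inequality with polynomial slack, from
`brickHalfSpaceCount_mul_brickBridgeCount_le`, true loss `m + 1`).
[cite: MadrasSlade1993, §7.5 eqs. (7.5.1)–(7.5.2)] -/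
private theorem hsc_mul_brickBridgeCount_le_pow_six (m M : ℕ) :
    (brickHalfSpaceCount m : ℝ) * brickBridgeCount M ≤
      (4 * (m : ℝ) + 4 * M + 3) ^ 6 * brickHalfSpaceCount (m + M) := by
  have h : (brickHalfSpaceCount m : ℝ) * brickBridgeCount M ≤ ((m : ℝ) + 1) * brickHalfSpaceCount (m + M) := by
    exact_mod_cast brickHalfSpaceCount_mul_brickBridgeCount_le m M
  have hm : (0 : ℝ) ≤ m := Nat.cast_nonneg m
  have hM : (0 : ℝ) ≤ M := Nat.cast_nonneg M
  have hx1 : (1 : ℝ) ≤ 4 * (m : ℝ) + 4 * M + 3 := by linarith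
  have hx : (m : ℝ) + 1 ≤ 4 * (m : ℝ) + 4 * M + 3 := by linarith
  have hpoly : (m : ℝ) + 1 ≤ (4 * (m : ℝ) + 4 * M + 3) ^ 6 := hx.trans (le_self_pow₀ hx1 (by norm_num))
  exact h.trans (mul_le_mul_of_nonneg_right hpoly (Nat.cast_nonneg _))

/-- `h_{n+1}(𝕋) ≤ 6 h_n(𝕋)` in ratio form (`h_{n+1} ≤ h_n c_1`, `c_1(𝕋) = 6`). [cite: MadrasSlade1993, eq. (1.2.3)] -/
private theorem hs_ratio_le_six (n : ℕ) : (brickHalfSpaceCount (n + 1) : ℝ) / brickHalfSpaceCount n ≤ 6 := by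
  have h0 : (0 : ℝ) < brickHalfSpaceCount n := by exact_mod_cast one_le_brickHalfSpaceCount n
  rw [div_le_iff₀ h0]
  have h2 : triSawCount 1 ≤ 6 := by simpa using triSawCount_succ_le 0
  have : brickHalfSpaceCount (n + 1) ≤ 6 * brickHalfSpaceCount n :=
    calc brickHalfSpaceCount (n + 1) ≤ brickHalfSpaceCount n * triSawCount 1 := brickHalfSpaceCount_add_le n 1
      _ ≤ brickHalfSpaceCount n * 6 := Nat.mul_le_mul_left _ h2
      _ = 6 * brickHalfSpaceCount n := by ring
  exact_mod_cast this

/-! ### Kesten's inequality (7.3.3) on `𝕋` for all `n ≥ 1` -/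

/-- **(7.3.3) on `𝕋`, all `n ≥ 1`**: there is `B ≥ max(1, μ(𝕋))` with `h_{n+1}/h_n − B/n ≤ h_{n+2}/h_{n+1}` for every
`n ≥ 1` (from `kestenIneqTriHalfSpace`: divide `φ_n² − D/n ≤ φ_n φ_{n+1}` by `φ_n ≥ 1`; below its threshold use
`φ_n ≤ c_1(𝕋) ≤ 6 ≤ B/n` (`h_{n+1} ≤ h_n c_1`)).
[cite: MadrasSlade1993, Lemma 7.3.1 (7.3.3) (p. 242) and p. 244 Remark] -/
theorem kestenIneqTriHalfSpace_all : ∃ B : ℝ, 1 ≤ B ∧ Real.exp logMuTri ≤ B ∧ ∀ n : ℕ, 1 ≤ n →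
    (brickHalfSpaceCount (n + 1) : ℝ) / brickHalfSpaceCount n - B / n ≤
      (brickHalfSpaceCount (n + 2) : ℝ) / brickHalfSpaceCount (n + 1) := by
  obtain ⟨D, hD⟩ := kestenIneqTriHalfSpace
  obtain ⟨N₀, hN₀⟩ := Filter.eventually_atTop.1 hD
  have ha : ∀ n, (0 : ℝ) < brickHalfSpaceCount n := fun n => by exact_mod_cast one_le_brickHalfSpaceCount n
  set B : ℝ := max (max |D| (6 * ((N₀ : ℝ) + 1))) (max 1 (Real.exp logMuTri)) with hB
  refine ⟨B, (le_max_left _ _).trans (le_max_right _ _), (le_max_right _ _).trans (le_max_right _ _),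
    fun n hn => ?_⟩
  have hn0 : (0 : ℝ) < n := by exact_mod_cast hn
  have hpos : 0 < (brickHalfSpaceCount (n + 2) : ℝ) / brickHalfSpaceCount (n + 1) := div_pos (ha _) (ha _)
  rcases Nat.lt_or_ge n N₀ with hlt | hge
  · have h6 := hs_ratio_le_six n
    have hBn : 6 ≤ B / n := by
      rw [le_div_iff₀ hn0]
      have hle : (n : ℝ) ≤ (N₀ : ℝ) + 1 := by
        have : n ≤ N₀ + 1 := by omega
        exact_mod_cast this
      calc 6 * (n : ℝ) ≤ 6 * ((N₀ : ℝ) + 1) := by linarith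
        _ ≤ B := (le_max_right _ _).trans (le_max_left _ _)
    linarith
  · have hKn := hN₀ n hge
    have hc := one_le_brickHalfSpaceCount_ratio n
    set r : ℝ := (brickHalfSpaceCount (n + 1) : ℝ) / brickHalfSpaceCount n with hr
    have hr0 : 0 < r := lt_of_lt_of_le one_pos hc
    have key : r - D / (n * r) ≤ (brickHalfSpaceCount (n + 2) : ℝ) / brickHalfSpaceCount (n + 1) := by
      have h1 : r * (r - D / (n * r)) = r ^ 2 - D / n := by
        field_simp
      have h2 : r * (r - D / (n * r)) ≤ r * ((brickHalfSpaceCount (n + 2) : ℝ) / brickHalfSpaceCount (n + 1)) := by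
        rw [h1]; exact hKn
      exact le_of_mul_le_mul_left h2 hr0
    have hDB : D / (n * r) ≤ B / n := by
      calc D / (n * r) ≤ |D| / (n * r) := div_le_div_of_nonneg_right (le_abs_self D) (by positivity)
        _ ≤ |D| / (n * 1) :=
            div_le_div_of_nonneg_left (abs_nonneg D) (by positivity) (mul_le_mul_of_nonneg_left hc hn0.le)
        _ = |D| / n := by rw [mul_one]
        _ ≤ B / n := div_le_div_of_nonneg_right ((le_max_left _ _).trans (le_max_left _ _)) hn0.le
    linarith

namespace TriHalfSpaceRate

/-! ### Doubling adapters: the two-step abstract lemmas read on `a(k) = c_{⌊k/2⌋}` and `a(k) = c_{⌈k/2⌉}` -/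

/-- `exp(logMuTri/2)² = μ(𝕋)`. [folklore] -/
private theorem halfMu_sq : Real.exp (logMuTri / 2) ^ 2 = Real.exp logMuTri := by
  rw [sq, ← Real.exp_add, add_halves]

/-- `1 ≤ exp(logMuTri/2)`. [folklore] -/
private theorem one_le_halfMu : 1 ≤ Real.exp (logMuTri / 2) :=
  Real.one_le_exp (by have := logMuTri_pos; linarith)

/-- Floor doubling of (7.3.3): from `φ_n − B/n ≤ φ_{n+1}` (all `n ≥ 1`) to the two-step shape on
`a(k) = c_{⌊k/2⌋}(𝕋)` with `B' = max(3B, 6)` (`n ≤ 3⌊n/2⌋` for `n ≥ 2`; at `n = 1`: `φ_0 = c_1(𝕋) ≤ 6`).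
[cite: MadrasSlade1993, Lemma 7.3.1 (7.3.3)] -/
private theorem doubling_kesten {B : ℝ} (hB1 : 1 ≤ B)
    (hK : ∀ n : ℕ, 1 ≤ n →
      (brickHalfSpaceCount (n + 1) : ℝ) / brickHalfSpaceCount n - B / n ≤ (brickHalfSpaceCount (n + 2) : ℝ) / brickHalfSpaceCount (n + 1)) :
    ∀ n : ℕ, 1 ≤ n → (brickHalfSpaceCount ((n + 2) / 2) : ℝ) / brickHalfSpaceCount (n / 2) - max (3 * B) 6 / n ≤
      (brickHalfSpaceCount ((n + 4) / 2) : ℝ) / brickHalfSpaceCount ((n + 2) / 2) := by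
  have ha : ∀ n, (0 : ℝ) < brickHalfSpaceCount n := fun n => by exact_mod_cast one_le_brickHalfSpaceCount n
  intro n hn
  have e2 : (n + 2) / 2 = n / 2 + 1 := by omega
  have e4 : (n + 4) / 2 = n / 2 + 2 := by omega
  rw [e2, e4]
  have hn0 : (0 : ℝ) < n := by exact_mod_cast hn
  rcases Nat.eq_zero_or_pos (n / 2) with hm0 | hmpos
  · have hn1 : (n : ℝ) = 1 := by
      have : n = 1 := by omega
      exact_mod_cast this
    rw [hm0, hn1, div_one]
    have hφ0 : (brickHalfSpaceCount (0 + 1) : ℝ) / brickHalfSpaceCount 0 ≤ 6 := hs_ratio_le_six 0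
    have hφ1 : 0 < (brickHalfSpaceCount (0 + 2) : ℝ) / brickHalfSpaceCount (0 + 1) := div_pos (ha _) (ha _)
    have h6 : (6 : ℝ) ≤ max (3 * B) 6 := le_max_right _ _
    linarith
  · have hk := hK (n / 2) hmpos
    have hmn : (n : ℝ) ≤ 3 * ((n / 2 : ℕ) : ℝ) := by
      have : n ≤ 3 * (n / 2) := by omega
      exact_mod_cast this
    have hm0 : (0 : ℝ) < ((n / 2 : ℕ) : ℝ) := by exact_mod_cast hmpos
    have hBB : B / ((n / 2 : ℕ) : ℝ) ≤ max (3 * B) 6 / n := by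
      rw [div_le_div_iff₀ hm0 hn0]
      calc B * n ≤ B * (3 * ((n / 2 : ℕ) : ℝ)) := mul_le_mul_of_nonneg_left hmn (by linarith)
        _ = 3 * B * ((n / 2 : ℕ) : ℝ) := by ring
        _ ≤ max (3 * B) 6 * ((n / 2 : ℕ) : ℝ) := mul_le_mul_of_nonneg_right (le_max_left _ _) hm0.le
    linarith

/-- Floor-doubled submultiplicativity: `a(N + 2M) ≤ a(N) · c_M(𝕋)`. [cite: MadrasSlade1993, eq. (1.2.3)] -/
private theorem doubling_sub (N M : ℕ) :
    (brickHalfSpaceCount ((N + 2 * M) / 2) : ℝ) ≤ brickHalfSpaceCount (N / 2) * triSawCount M := by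
  have e : (N + 2 * M) / 2 = N / 2 + M := by omega
  rw [e]; exact_mod_cast brickHalfSpaceCount_add_le (N / 2) M

/-- Ceiling doubling of (7.3.3): the two-step shape on `a(k) = c_{⌈k/2⌉}(𝕋) = c((k+1)/2)` with `B ↦ 2B` (no small
case: `⌈n/2⌉ ≥ 1` for `n ≥ 1`). [cite: MadrasSlade1993, Lemma 7.3.1 (7.3.3)] -/
private theorem cdbl_kesten {B : ℝ} (hB0 : 0 ≤ B)
    (hK : ∀ n : ℕ, 1 ≤ n →
      (brickHalfSpaceCount (n + 1) : ℝ) / brickHalfSpaceCount n - B / n ≤ (brickHalfSpaceCount (n + 2) : ℝ) / brickHalfSpaceCount (n + 1)) :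
    ∀ n : ℕ, 1 ≤ n → (brickHalfSpaceCount ((n + 2 + 1) / 2) : ℝ) / brickHalfSpaceCount ((n + 1) / 2) - 2 * B / n ≤
      (brickHalfSpaceCount ((n + 4 + 1) / 2) : ℝ) / brickHalfSpaceCount ((n + 2 + 1) / 2) := by
  intro n hn
  have hm : 1 ≤ (n + 1) / 2 := by omega
  have e2 : (n + 2 + 1) / 2 = (n + 1) / 2 + 1 := by omega
  have e4 : (n + 4 + 1) / 2 = (n + 1) / 2 + 2 := by omega
  rw [e2, e4]
  have hk := hK ((n + 1) / 2) hm
  have hn0 : (0 : ℝ) < n := by exact_mod_cast hn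
  have hm0 : (0 : ℝ) < (((n + 1) / 2 : ℕ) : ℝ) := by exact_mod_cast hm
  have hmn : (n : ℝ) ≤ 2 * (((n + 1) / 2 : ℕ) : ℝ) := by
    have : n ≤ 2 * ((n + 1) / 2) := by omega
    exact_mod_cast this
  have hBB : B / (((n + 1) / 2 : ℕ) : ℝ) ≤ 2 * B / n := by
    rw [div_le_div_iff₀ hm0 hn0]
    nlinarith
  linarith

/-- Reading a bound at `2m` back at `m`: `K (2m)^{-1/3} ≤ max(K,0) · m^{-1/3}`. [folklore] -/
private theorem mul_rpow_two_mul_le (K : ℝ) {m : ℕ} (hm : 1 ≤ m) :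
    K * ((2 * m : ℕ) : ℝ) ^ (-(1 : ℝ) / 3) ≤ max K 0 * (m : ℝ) ^ (-(1 : ℝ) / 3) := by
  have hm0 : (0 : ℝ) < m := by exact_mod_cast hm
  have hp : 0 ≤ (m : ℝ) ^ (-(1 : ℝ) / 3) := Real.rpow_nonneg hm0.le _
  have hcmp : ((2 * m : ℕ) : ℝ) ^ (-(1 : ℝ) / 3) ≤ (m : ℝ) ^ (-(1 : ℝ) / 3) := by
    push_cast
    rw [Real.mul_rpow (by norm_num) hm0.le]
    have h2 : (2 : ℝ) ^ (-(1 : ℝ) / 3) ≤ 1 := Real.rpow_le_one_of_one_le_of_nonpos (by norm_num) (by norm_num)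
    have := mul_le_mul_of_nonneg_right h2 hp
    linarith
  have hp2 : 0 ≤ ((2 * m : ℕ) : ℝ) ^ (-(1 : ℝ) / 3) := Real.rpow_nonneg (by positivity) _
  calc K * ((2 * m : ℕ) : ℝ) ^ (-(1 : ℝ) / 3) ≤ max K 0 * ((2 * m : ℕ) : ℝ) ^ (-(1 : ℝ) / 3) :=
        mul_le_mul_of_nonneg_right (le_max_left _ _) hp2
    _ ≤ max K 0 * (m : ℝ) ^ (-(1 : ℝ) / 3) := mul_le_mul_of_nonneg_left hcmp (le_max_right _ _)

/-- **Lower side, eventually**: `−K N^{-1/3} ≤ h_{N+1}(𝕋)/h_N(𝕋) − μ(𝕋)` for `N ≥ N₀` — the tree's abstract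
`Zd.KestenRateLower.lower_rate_cubeRoot_ins` on the ceiling-doubled sequence (residue `0`), pieces `e = b(𝕋)` with
envelope `e^{−15√M} μ^M ≤ b_M` and the bridge insertion `h_m b_M ≤ (4m+4M+3)^6 h_{m+M}`.
[cite: MadrasSlade1993, §7.5 eqs. (7.5.1)–(7.5.2) (p. 255)] -/
theorem le_ratio_sub_rpow_eventually : ∃ K : ℝ, ∃ N₀ : ℕ, ∀ N : ℕ, N₀ ≤ N →
    -(K * (N : ℝ) ^ (-(1 : ℝ) / 3)) ≤ (brickHalfSpaceCount (N + 1) : ℝ) / brickHalfSpaceCount N - Real.exp logMuTri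
    := by
  obtain ⟨B₁, hB1, hBμ, hK⟩ := kestenIneqTriHalfSpace_all
  set μ := Real.exp logMuTri with hμdef
  set ν := Real.exp (logMuTri / 2) with hνdef
  set e : ℕ → ℝ := fun M => (brickBridgeCount M : ℝ) with hedef
  have hν1 : 1 ≤ ν := one_le_halfMu
  have hν2 : ν ^ 2 = μ := halfMu_sq
  have ha : ∀ k, (0 : ℝ) < brickHalfSpaceCount ((k + 1) / 2) := fun k => by exact_mod_cast one_le_brickHalfSpaceCount _
  set B : ℝ := max (2 * B₁) μ with hBdef
  have hB1' : 1 ≤ B := le_trans (by linarith) (le_max_left _ _)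
  have hνB : ν ^ 2 ≤ B := by rw [hν2]; exact le_max_right _ _
  have hKd : ∀ n : ℕ, 1 ≤ n → (brickHalfSpaceCount ((n + 2 + 1) / 2) : ℝ) / brickHalfSpaceCount ((n + 1) / 2) - B / n ≤
      (brickHalfSpaceCount ((n + 4 + 1) / 2) : ℝ) / brickHalfSpaceCount ((n + 2 + 1) / 2) := by
    intro n hn
    have h := cdbl_kesten (by linarith) hK n hn
    have hn0 : (0 : ℝ) < n := by exact_mod_cast hn
    have : 2 * B₁ / n ≤ B / n := div_le_div_of_nonneg_right (le_max_left _ _) hn0.le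
    linarith
  have hlo : ∀ M : ℕ, 2 ≤ M → Real.exp (-((15 : ℝ) * Real.sqrt M)) * ν ^ (2 * M) ≤ 1 * e M := by
    intro M _
    rw [pow_mul, hν2, one_mul]
    exact exp_neg_mul_pow_le_brickBridgeCount M
  have hSM : ∀ N' M : ℕ, 0 ≤ N' → N' % 2 = 0 → 2 ≤ M →
      (brickHalfSpaceCount ((N' + 1) / 2) : ℝ) * e M ≤
        (2 * ((N' : ℝ) + 2 * M) + 3) ^ 6 * brickHalfSpaceCount ((N' + 2 * M + 1) / 2) := by
    intro N' M _ hpar _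
    have e1 : (N' + 1) / 2 = N' / 2 := by omega
    have e2 : (N' + 2 * M + 1) / 2 = N' / 2 + M := by omega
    rw [e1, e2]
    have h := hsc_mul_brickBridgeCount_le_pow_six (N' / 2) M
    have h2 : ((N' / 2 : ℕ) : ℝ) * 2 = N' := by
      have : N' / 2 * 2 = N' := by omega
      exact_mod_cast this
    have hcast : (4 * ((N' / 2 : ℕ) : ℝ) + 4 * M + 3) = 2 * ((N' : ℝ) + 2 * M) + 3 := by linarith
    rw [hcast] at h
    exact h
  obtain ⟨K, hKr⟩ := Zd.KestenRateLower.lower_rate_cubeRoot_ins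
    (a := fun k => (brickHalfSpaceCount ((k + 1) / 2) : ℝ)) (e := e) (μ := ν) (B := B) (c := 15) (A := 1)
    (n₁ := 0) (r := 0) ha hν1 hB1' hνB (by norm_num) le_rfl hKd hlo hSM
  refine ⟨max K 0, 1, fun m hm => ?_⟩
  have hm0 : (0 : ℝ) < m := by exact_mod_cast hm
  have hp : 0 ≤ (m : ℝ) ^ (-(1 : ℝ) / 3) := Real.rpow_nonneg hm0.le _
  rcases le_or_gt μ ((brickHalfSpaceCount (m + 1) : ℝ) / brickHalfSpaceCount m) with h | h
  · have : 0 ≤ max K 0 * (m : ℝ) ^ (-(1 : ℝ) / 3) := mul_nonneg (le_max_right _ _) hp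
    linarith
  · have hN : 2 * 0 + 1 ≤ 2 * m := by omega
    have hpar : (2 * m) % 2 = 0 := by omega
    have e1 : (2 * m + 2 + 1) / 2 = m + 1 := by omega
    have e2 : (2 * m + 1) / 2 = m := by omega
    have hdev : (brickHalfSpaceCount ((2 * m + 2 + 1) / 2) : ℝ) / brickHalfSpaceCount ((2 * m + 1) / 2) ≤
        ν ^ 2 - (μ - (brickHalfSpaceCount (m + 1) : ℝ) / brickHalfSpaceCount m) := by
      rw [e1, e2, hν2]; linarith
    have hv := hKr (2 * m) hN hpar _ (by linarith) hdev
    have hK0 := mul_rpow_two_mul_le K hm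
    linarith

end TriHalfSpaceRate

open TriHalfSpaceRate

/-! ### The rate with Kesten's exponent `1/3` on both sides -/

/-- **Upper side**: `h_{N+1}(𝕋)/h_N(𝕋) − μ(𝕋) ≤ K N^{-1/3}` for every `N ≥ 1` — the tree's abstract
`Zd.KestenRateUpper.upper_rate_cubeRoot_sub` on `a(k) = h_{⌊k/2⌋}(𝕋)` with the Hammersley–Welsh envelope `triHW` for
the partner sequence `c(𝕋)` and the cut inequality `h_{m+M} ≤ h_m c_M`.
[cite: MadrasSlade1993, §7.5 eq. (7.5.1) (p. 255); Lemma 7.3.1 (p. 242)] -/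
theorem brickHalfSpaceCount_ratio_sub_le_rpow : ∃ K : ℝ, ∀ N : ℕ, 1 ≤ N →
    (brickHalfSpaceCount (N + 1) : ℝ) / brickHalfSpaceCount N - Real.exp logMuTri ≤ K * (N : ℝ) ^ (-(1 : ℝ) / 3) := by
  obtain ⟨K₁, hHW⟩ := triHW
  obtain ⟨B, hB1, -, hK⟩ := kestenIneqTriHalfSpace_all
  set μ := Real.exp logMuTri with hμdef
  set ν := Real.exp (logMuTri / 2) with hνdef
  have hμ0 : 0 < μ := Real.exp_pos _
  have hν1 : 1 ≤ ν := one_le_halfMu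
  have hν2 : ν ^ 2 = μ := halfMu_sq
  have ha' : ∀ n, (0 : ℝ) < brickHalfSpaceCount n := fun n => by exact_mod_cast one_le_brickHalfSpaceCount n
  have ha : ∀ k, (0 : ℝ) < brickHalfSpaceCount (k / 2) := fun k => ha' _
  have hB1' : (1 : ℝ) ≤ max (3 * B) 6 := le_trans (by norm_num) (le_max_right _ _)
  have hA1 : (1 : ℝ) ≤ triSawCount 0 := by exact_mod_cast one_le_triSawCount 0
  have hKd := doubling_kesten hB1 hK
  have hhi : ∀ M : ℕ, (triSawCount M : ℝ) ≤
      (triSawCount 0 : ℝ) * Real.exp (max K₁ 0 * Real.sqrt M) * ν ^ (2 * M) := by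
    intro M
    rw [pow_mul, hν2]
    rcases Nat.eq_zero_or_pos M with rfl | hM
    · simp
    · calc (triSawCount M : ℝ) ≤ Real.exp (K₁ * Real.sqrt M) * μ ^ M := hHW M hM
        _ ≤ Real.exp (max K₁ 0 * Real.sqrt M) * μ ^ M :=
            mul_le_mul_of_nonneg_right
              (Real.exp_le_exp.2 (mul_le_mul_of_nonneg_right (le_max_left _ _) (Real.sqrt_nonneg _)))
              (pow_nonneg hμ0.le _)
        _ ≤ (triSawCount 0 : ℝ) * Real.exp (max K₁ 0 * Real.sqrt M) * μ ^ M := by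
            rw [mul_assoc]; exact le_mul_of_one_le_left (by positivity) hA1
  obtain ⟨K, hKr⟩ := Zd.KestenRateUpper.upper_rate_cubeRoot_sub (a := fun k => (brickHalfSpaceCount (k / 2) : ℝ))
    (a₂ := fun M => (triSawCount M : ℝ)) (μ := ν) (B := max (3 * B) 6) (c := max K₁ 0)
    (A := (triSawCount 0 : ℝ)) ha hν1 hB1' hA1 hKd doubling_sub hhi
  refine ⟨max K 0, fun m hm => ?_⟩
  have hm0 : (0 : ℝ) < m := by exact_mod_cast hm
  have hp : 0 ≤ (m : ℝ) ^ (-(1 : ℝ) / 3) := Real.rpow_nonneg hm0.le _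
  rcases le_or_gt ((brickHalfSpaceCount (m + 1) : ℝ) / brickHalfSpaceCount m) μ with h | h
  · have : 0 ≤ max K 0 * (m : ℝ) ^ (-(1 : ℝ) / 3) := mul_nonneg (le_max_right _ _) hp
    linarith
  · have h2m : 1 ≤ 2 * m := by omega
    have e1 : (2 * m + 2) / 2 = m + 1 := by omega
    have e2 : 2 * m / 2 = m := by omega
    have hdev : ν ^ 2 + ((brickHalfSpaceCount (m + 1) : ℝ) / brickHalfSpaceCount m - μ) ≤
        (brickHalfSpaceCount ((2 * m + 2) / 2) : ℝ) / brickHalfSpaceCount (2 * m / 2) := by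
      rw [e1, e2, hν2]; linarith
    have hu := hKr (2 * m) h2m _ (by linarith) hdev
    have hK0 := mul_rpow_two_mul_le K hm
    linarith

/-- **Lower side**: `−K N^{-1/3} ≤ h_{N+1}(𝕋)/h_N(𝕋) − μ(𝕋)` for every `N ≥ 1` (the finitely many `N` below the
threshold of `le_ratio_sub_rpow_eventually` are absorbed: `μ − φ_N ≤ μ ≤ μ (N₀+1)^{1/3} · N^{-1/3}`).
[cite: MadrasSlade1993, §7.5 eqs. (7.5.1)–(7.5.2) (p. 255)] -/
theorem le_brickHalfSpaceCount_ratio_sub_rpow : ∃ K : ℝ, ∀ N : ℕ, 1 ≤ N →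
    -(K * (N : ℝ) ^ (-(1 : ℝ) / 3)) ≤ (brickHalfSpaceCount (N + 1) : ℝ) / brickHalfSpaceCount N - Real.exp logMuTri
    := by
  obtain ⟨K₂, N₀, h₂⟩ := le_ratio_sub_rpow_eventually
  set μ := Real.exp logMuTri with hμdef
  have hμ0 : 0 < μ := Real.exp_pos _
  set K₃ : ℝ := μ * ((N₀ : ℝ) + 1) ^ ((1 : ℝ) / 3) with hK₃
  have hK₃0 : 0 ≤ K₃ := by positivity
  refine ⟨max K₂ K₃, fun N hN => ?_⟩
  have hN0 : (0 : ℝ) < N := by exact_mod_cast hN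
  have hp : 0 ≤ (N : ℝ) ^ (-(1 : ℝ) / 3) := Real.rpow_nonneg hN0.le _
  rcases Nat.lt_or_ge N N₀ with hlt | hge
  · -- small `N`: `μ − φ_N ≤ μ ≤ K₃ N^{-1/3}`
    have hφ1 : (1 : ℝ) ≤ (brickHalfSpaceCount (N + 1) : ℝ) / brickHalfSpaceCount N := one_le_brickHalfSpaceCount_ratio N
    have hNle : (N : ℝ) ≤ (N₀ : ℝ) + 1 := by
      have : N ≤ N₀ + 1 := by omega
      exact_mod_cast this
    have hcmp : ((N₀ : ℝ) + 1) ^ (-(1 : ℝ) / 3) ≤ (N : ℝ) ^ (-(1 : ℝ) / 3) :=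
      Real.rpow_le_rpow_of_nonpos hN0 hNle (by norm_num)
    have hprod : ((N₀ : ℝ) + 1) ^ ((1 : ℝ) / 3) * ((N₀ : ℝ) + 1) ^ (-(1 : ℝ) / 3) = 1 := by
      rw [← Real.rpow_add (by positivity)]
      norm_num
    have hK3N : μ ≤ K₃ * (N : ℝ) ^ (-(1 : ℝ) / 3) := by
      calc μ = K₃ * ((N₀ : ℝ) + 1) ^ (-(1 : ℝ) / 3) := by rw [hK₃, mul_assoc, hprod, mul_one]
        _ ≤ K₃ * (N : ℝ) ^ (-(1 : ℝ) / 3) := mul_le_mul_of_nonneg_left hcmp hK₃0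
    have hle : K₃ * (N : ℝ) ^ (-(1 : ℝ) / 3) ≤ max K₂ K₃ * (N : ℝ) ^ (-(1 : ℝ) / 3) :=
      mul_le_mul_of_nonneg_right (le_max_right _ _) hp
    linarith
  · have := h₂ N hge
    have hle : K₂ * (N : ℝ) ^ (-(1 : ℝ) / 3) ≤ max K₂ K₃ * (N : ℝ) ^ (-(1 : ℝ) / 3) :=
      mul_le_mul_of_nonneg_right (le_max_left _ _) hp
    linarith

/-- **Kesten's ratio rate for the half-space walks of the triangular lattice, one step, both sides, every `N ≥ 1`**:
`|h_{N+1}(𝕋)/h_N(𝕋) − μ(𝕋)| ≤ K · N^{-1/3}`.  The `N^{-1/3}` rate is printed for ALL walks on `ℤ^d` (two-step) only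
[cite: MadrasSlade1993, §7.5 eq. (7.5.1) (p. 255)]; the half-space one-step LIMIT on `ℤ^d` is
[cite: LawlerSchrammWerner2004SAW, Appendix A, (A.3)] (no rate); nothing for `𝕋` located in print. -/
theorem abs_brickHalfSpaceCount_ratio_sub_le_rpow : ∃ K : ℝ, ∀ N : ℕ, 1 ≤ N →
    |(brickHalfSpaceCount (N + 1) : ℝ) / brickHalfSpaceCount N - Real.exp logMuTri| ≤ K * (N : ℝ) ^ (-(1 : ℝ) / 3)
    := by
  obtain ⟨K₁, h₁⟩ := brickHalfSpaceCount_ratio_sub_le_rpow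
  obtain ⟨K₂, h₂⟩ := le_brickHalfSpaceCount_ratio_sub_rpow
  refine ⟨max K₁ K₂, fun N hN => ?_⟩
  have hp : 0 ≤ (N : ℝ) ^ (-(1 : ℝ) / 3) := Real.rpow_nonneg (Nat.cast_nonneg _) _
  have hle₁ := mul_le_mul_of_nonneg_right (le_max_left K₁ K₂) hp
  have hle₂ := mul_le_mul_of_nonneg_right (le_max_right K₁ K₂) hp
  exact abs_le.2 ⟨by linarith [h₂ N hN], by linarith [h₁ N hN]⟩

/-- The `∀ᶠ` form: `∃ K, ∀ᶠ N, |h_{N+1}(𝕋)/h_N(𝕋) − μ(𝕋)| ≤ K N^{-1/3}`.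
[cite: MadrasSlade1993, §7.5 eq. (7.5.1) (p. 255)] -/
theorem brickHalfSpaceCount_ratio_rate : ∃ K : ℝ, ∀ᶠ N : ℕ in atTop,
    |(brickHalfSpaceCount (N + 1) : ℝ) / brickHalfSpaceCount N - Real.exp logMuTri| ≤ K * (N : ℝ) ^ (-(1 / 3 : ℝ)) := by
  obtain ⟨K, hK⟩ := abs_brickHalfSpaceCount_ratio_sub_le_rpow
  refine ⟨K, Filter.eventually_atTop.2 ⟨1, fun N hN => ?_⟩⟩
  rw [show (-(1 / 3 : ℝ)) = -(1 : ℝ) / 3 by norm_num]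
  exact hK N hN

/-- The lane's R78 target face `TriHalfSpaceRatioRate` verbatim (`∃ K N₀, ∀ N ≥ N₀, …`), from the `∀ N ≥ 1` form.
[cite: LawlerSchrammWerner2004SAW, Appendix A, (A.3)] [cite: MadrasSlade1993, §7.5 eq. (7.5.1) (p. 255)] -/
theorem brickHalfSpaceCount_ratio_rate_eventually : ∃ K : ℝ, ∃ N₀ : ℕ, ∀ N : ℕ, N₀ ≤ N →
    |(brickHalfSpaceCount (N + 1) : ℝ) / brickHalfSpaceCount N - Real.exp logMuTri| ≤
      K * (N : ℝ) ^ (-(1 : ℝ) / 3) := by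
  obtain ⟨K, hK⟩ := abs_brickHalfSpaceCount_ratio_sub_le_rpow
  exact ⟨K, 1, hK⟩

end Literature.Probability.RandomPlanarGeometry.SAW
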